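import Mathlib
import Summits.Ventures.HodgeRepro2.CanonicalAutomorphyFactor
import Summits.Ventures.HodgeRepro2.BallHomogeneous

/-!
# The stabiliser of the origin in `U(2,1)` and its action on `𝔭⁺`

Kernel annex of the blind cell `pub-hodge-repro2` (seat p2), for the Tier-5 sub-step N1
(route/T5-ID-p2.md §ID-4 / Remark ID-4.1: the `K₁`-type of `∧²𝔭⁺` is `det₂ ⊗ z^{−2}`).  In the
coordinates of `Hypothesis.lean`, an element `k ∈ U(2,1)` fixing the origin of the ball is
block-diagonal, `k = diag(A, d)` with `A ∈ U(2)` and `|d| = 1`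
(`fixes_origin_iff`, `last_row_eq_zero_of_fixes_origin`, `norm_apply_two_two_eq_one`), its
Jacobian at the origin is `A/d` (**`jacobian_zero_apply_of_fixes_origin`**) — the action of
`K = U(2) × U(1)` on the tangent space `𝔭⁺ = T₀𝔹²` — and the character of `K` on `∧²𝔭⁺`
is `det A / d²` (**`det_jacobian_zero_of_fixes_origin`**), i.e. `det₂ ⊗ z^{−2}`.
-/

namespace Summit.Ventures.HodgeRepro2.ShimuraData

open Matrix

/-- `j(k, 0) = k₂₂`. -/
theorem autFactor_zero (k : Matrix (Fin 3) (Fin 3) ℂ) : autFactor k 0 = k 2 2 := by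
  simp [autFactor, Matrix.mulVec, dotProduct, Fin.sum_univ_three, homog_zero, homog_one, homog_two]

/-- The coordinates of `k·0`: `(k·0)ᵢ = kᵢ₂ / k₂₂`. -/
theorem ballAction_zero_apply (k : Matrix (Fin 3) (Fin 3) ℂ) (i : Fin 2) :
    ballAction k 0 i = k i.castSucc 2 / k 2 2 := by
  simp [ballAction, Matrix.mulVec, dotProduct, Fin.sum_univ_three, homog_zero, homog_one, homog_two]

/-- The `(i, j)` entry of the unitarity relation `kᴴ J k = J`. -/
theorem isInU21_entry {k : Matrix (Fin 3) (Fin 3) ℂ} (hk : IsInU21 k) (i j : Fin 3) :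
    star (k 0 i) * k 0 j + star (k 1 i) * k 1 j - star (k 2 i) * k 2 j =
      Matrix.diagonal ![1, 1, -1] i j := by
  have h := congrFun (congrFun hk i) j
  simp only [J21] at h
  rw [Matrix.mul_apply] at h
  simp only [Matrix.mul_diagonal, Matrix.conjTranspose_apply, Fin.sum_univ_three] at h
  have e2 : (![1, 1, -1] : Fin 3 → ℂ) 2 = -1 := rfl
  have e1 : (![1, 1, -1] : Fin 3 → ℂ) 1 = 1 := rfl
  have e0 : (![1, 1, -1] : Fin 3 → ℂ) 0 = 1 := rfl
  rw [e0, e1, e2] at h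
  linear_combination h

/-- `k₂₂ ≠ 0` for `k ∈ U(2,1)` (`j(k, 0) ≠ 0`). -/
theorem IsInU21.apply_two_two_ne_zero {k : Matrix (Fin 3) (Fin 3) ℂ} (hk : IsInU21 k) :
    k 2 2 ≠ 0 := by
  have := hk.autFactor_ne_zero zero_mem_ball₂
  rwa [autFactor_zero] at this

/-- `k ∈ U(2,1)` fixes the origin iff `k₀₂ = k₁₂ = 0`. -/
theorem fixes_origin_iff {k : Matrix (Fin 3) (Fin 3) ℂ} (hk : IsInU21 k) :
    ballAction k 0 = 0 ↔ k 0 2 = 0 ∧ k 1 2 = 0 := by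
  have hd : k 2 2 ≠ 0 := hk.apply_two_two_ne_zero
  constructor
  · intro h
    have h0 := congrFun h 0
    have h1 := congrFun h 1
    rw [ballAction_zero_apply, Pi.zero_apply, div_eq_zero_iff] at h0 h1
    exact ⟨h0.resolve_right hd, h1.resolve_right hd⟩
  · rintro ⟨h0, h1⟩
    funext i
    rw [ballAction_zero_apply, Pi.zero_apply]
    fin_cases i
    · simp [h0]
    · simp [h1]

/-- For `k ∈ U(2,1)` fixing the origin, the last row is `(0, 0, k₂₂)`. -/
theorem last_row_eq_zero_of_fixes_origin {k : Matrix (Fin 3) (Fin 3) ℂ} (hk : IsInU21 k)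
    (h0 : ballAction k 0 = 0) : k 2 0 = 0 ∧ k 2 1 = 0 := by
  obtain ⟨h02, h12⟩ := (fixes_origin_iff hk).1 h0
  have hd : k 2 2 ≠ 0 := hk.apply_two_two_ne_zero
  have e0 := isInU21_entry hk 0 2
  have e1 := isInU21_entry hk 1 2
  rw [h02, h12, Matrix.diagonal_apply_ne _ (by decide)] at e0
  rw [h02, h12, Matrix.diagonal_apply_ne _ (by decide)] at e1
  refine ⟨?_, ?_⟩
  · have : star (k 2 0) * k 2 2 = 0 := by linear_combination -e0
    have := (mul_eq_zero.1 this).resolve_right hd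
    simpa using this
  · have : star (k 2 1) * k 2 2 = 0 := by linear_combination -e1
    have := (mul_eq_zero.1 this).resolve_right hd
    simpa using this

/-- For `k ∈ U(2,1)` fixing the origin, `|k₂₂| = 1`. -/
theorem norm_apply_two_two_eq_one {k : Matrix (Fin 3) (Fin 3) ℂ} (hk : IsInU21 k)
    (h0 : ballAction k 0 = 0) : ‖k 2 2‖ = 1 := by
  obtain ⟨h02, h12⟩ := (fixes_origin_iff hk).1 h0
  have e := isInU21_entry hk 2 2
  rw [h02, h12, Matrix.diagonal_apply_eq] at e
  have e2 : (![1, 1, -1] : Fin 3 → ℂ) 2 = -1 := rfl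
  rw [e2] at e
  have h2 : (starRingEnd ℂ) (k 2 2) * k 2 2 = 1 := by linear_combination -e
  have h3 : Complex.normSq (k 2 2) = 1 := by
    have := Complex.mul_conj (k 2 2)
    rw [mul_comm, h2] at this
    exact_mod_cast this.symm
  rw [Complex.normSq_eq_norm_sq] at h3
  nlinarith [norm_nonneg (k 2 2), sq_nonneg (‖k 2 2‖ - 1), sq_nonneg (‖k 2 2‖ + 1)]

/-- **The Jacobian at the origin of `k ∈ K`**: `J_k(0) = A / k₂₂` where `A` is the upper-left
`2 × 2` block — the action of `K` on `𝔭⁺ = T₀𝔹²`. -/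
theorem jacobian_zero_apply_of_fixes_origin {k : Matrix (Fin 3) (Fin 3) ℂ} (hk : IsInU21 k)
    (h0 : ballAction k 0 = 0) (i j : Fin 2) :
    jacobian k 0 i j = k i.castSucc j.castSucc / k 2 2 := by
  obtain ⟨h02, h12⟩ := (fixes_origin_iff hk).1 h0
  have hd : k 2 2 ≠ 0 := hk.apply_two_two_ne_zero
  rw [jacobian_apply_eq hk zero_mem_ball₂, autFactor_zero]
  have hN : k.mulVec (homog 0) i.castSucc = 0 := by
    fin_cases i <;> simp [Matrix.mulVec, dotProduct, Fin.sum_univ_three, homog_zero, homog_one,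
      homog_two, h02, h12]
  rw [hN, zero_mul, sub_zero]
  field_simp

/-- **The character of `K` on `∧²𝔭⁺`**: `det J_k(0) = det A / k₂₂²` for `k = diag(A, k₂₂) ∈ K`
(Borel–Wallach's `det₂ ⊗ z^{−2}`, route/T5-ID-p2.md Remark ID-4.1). -/
theorem det_jacobian_zero_of_fixes_origin {k : Matrix (Fin 3) (Fin 3) ℂ} (hk : IsInU21 k)
    (h0 : ballAction k 0 = 0) :
    (jacobian k 0).det = (k 0 0 * k 1 1 - k 0 1 * k 1 0) / k 2 2 ^ 2 := by
  rw [Matrix.det_fin_two, jacobian_zero_apply_of_fixes_origin hk h0,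
    jacobian_zero_apply_of_fixes_origin hk h0, jacobian_zero_apply_of_fixes_origin hk h0,
    jacobian_zero_apply_of_fixes_origin hk h0]
  simp only [Fin.castSucc_zero, Fin.castSucc_one]
  ring

/-- For `k ∈ K`, `det k = det A · k₂₂` (block form). -/
theorem det_eq_of_fixes_origin {k : Matrix (Fin 3) (Fin 3) ℂ} (hk : IsInU21 k)
    (h0 : ballAction k 0 = 0) : k.det = (k 0 0 * k 1 1 - k 0 1 * k 1 0) * k 2 2 := by
  obtain ⟨h02, h12⟩ := (fixes_origin_iff hk).1 h0
  obtain ⟨h20, h21⟩ := last_row_eq_zero_of_fixes_origin hk h0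
  rw [Matrix.det_fin_three, h02, h12, h20, h21]
  ring

end Summit.Ventures.HodgeRepro2.ShimuraData
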